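import Literature.MathematicalPhysics.QuantumLattice.OverlapLocality

/-!
# Route `NestedDissectionSea`, support item `KineticEdge` (stmt-QuantumFields-13899) — helper 2/3:
# the Hermitian part of the Wilson hopping matrices and the lattice diamagnetic inequality

For the `r = 1` Wilson hopping matrix `W_μ = F_μ ⊗ ½(1 − γ_μ) + F_μᴴ ⊗ ½(1 + γ_μ)` of the tree
(`wilsonHop`, `F_μ = linkHop` the `U`-twisted forward shift on site ⊗ colour) and any fermion field
`v` on site × colour × spin of the four-torus `(ℤ/L)⁴`:

* `re_inner_wilsonHop_eq` — the HERMITIAN PART of `W_μ` is the spin-blind covariant hop: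
  `Re ⟨v, W_μ v⟩ = Re ⟨v, (F_μ ⊗ 1) v⟩`, because `(F_μᴴ ⊗ P⁺_μ)ᴴ = F_μ ⊗ P⁺_μ` and
  `P⁻_μ + P⁺_μ = 1` (Montvay–Münster 1994, §4.2: the Wilson term `r = 1` turns the Hermitian part of
  the hopping term into the γ-free covariant Laplacian hop);
* `reindex_linkHop_kronecker_one_mulVec` — `((F_μ ⊗ 1) v)(y,a,α) = Σ_b ρ(U(y,μ))_{ab} v(y+μ̂,b,α)`;
* `norm_site_inner_hop_le` — the LATTICE DIAMAGNETIC (Kato) INEQUALITY, sitewise: for unitary `ρ`,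
  `|Σ_{a,α} conj(v(y,a,α)) Σ_b ρ(U(y,μ))_{ab} v(y+μ̂,b,α)| ≤ |v|(y) · |v|(y+μ̂)`,
  `|v|(y) = √(Σ_{a,α} |v(y,a,α)|²)` (Cauchy–Schwarz on `ℂ^{N×4}` and `ρ(U) ⊗ 1` an isometry;
  Brydges–Fröhlich–Seiler, Ann. Phys. 121 (1979), §2);
* `re_inner_wilsonHop_le` — hence `Re ⟨v, W_μ v⟩ ≤ Σ_y |v|(y) |v|(y+μ̂)`.

Standard material; Mathlib and the tree's `OverlapLocality` only (no definitions, no named facts).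
-/

noncomputable section

open Matrix
open scoped Kronecker ComplexConjugate
open Literature.MathematicalPhysics Literature.MathematicalPhysics.QuantumLattice
  Literature.MathematicalPhysics.QuantumFieldTheory Literature.Probability.LatticeModels

namespace Summit.QuantumFields.QCD.Theorems.KineticEdge

/-! ### Generic quadratic-form bookkeeping -/

section Generic

variable {n : Type*} [Fintype n]

/-- The quadratic form `Σ_i conj(v i) (M v)_i` is additive in the matrix. -/
theorem sum_conj_mul_add_mulVec (A B : Matrix n n ℂ) (v : n → ℂ) :
    ∑ i, conj (v i) * ((A + B) *ᵥ v) i =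
      (∑ i, conj (v i) * (A *ᵥ v) i) + ∑ i, conj (v i) * (B *ᵥ v) i := by
  rw [Matrix.add_mulVec, ← Finset.sum_add_distrib]
  refine Finset.sum_congr rfl fun i _ => ?_
  rw [Pi.add_apply, mul_add]

/-- `conj Σ_i conj(v i) (M v)_i = Σ_i conj(v i) (Mᴴ v)_i`. -/
theorem conj_sum_conj_mul_mulVec (M : Matrix n n ℂ) (v : n → ℂ) :
    conj (∑ i, conj (v i) * (M *ᵥ v) i) = ∑ i, conj (v i) * (Mᴴ *ᵥ v) i := by
  have h : ∀ A : Matrix n n ℂ, ∑ i, conj (v i) * (A *ᵥ v) i = star v ⬝ᵥ (A *ᵥ v) := fun A => rfl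
  rw [h, h]
  change star (star v ⬝ᵥ M *ᵥ v) = star v ⬝ᵥ Mᴴ *ᵥ v
  rw [← star_dotProduct_star, star_mulVec, star_star, ← dotProduct_mulVec]

/-- The real part of the quadratic form only sees the Hermitian part: `Re⟨v, M v⟩ = Re⟨v, Mᴴ v⟩`. -/
theorem re_sum_conj_mul_mulVec_conjTranspose (M : Matrix n n ℂ) (v : n → ℂ) :
    (∑ i, conj (v i) * (Mᴴ *ᵥ v) i).re = (∑ i, conj (v i) * (M *ᵥ v) i).re := by
  rw [← conj_sum_conj_mul_mulVec, Complex.conj_re]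

/-- `Re Σ_i conj(v i) v i... `: the diagonal form is `Σ_i ‖v i‖²`. -/
theorem sum_conj_mul_self_eq (v : n → ℂ) :
    ∑ i, conj (v i) * v i = ((∑ i, ‖v i‖ ^ 2 : ℝ) : ℂ) := by
  rw [Complex.ofReal_sum]
  refine Finset.sum_congr rfl fun i _ => ?_
  rw [Complex.conj_mul', Complex.ofReal_pow]

/-- An isometry `A` (`Aᴴ A = 1`) preserves `Σ_i ‖v i‖²`. -/
theorem sum_norm_sq_mulVec_of_isometry [DecidableEq n] (A : Matrix n n ℂ) (hA : Aᴴ * A = 1)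
    (v : n → ℂ) : ∑ i, ‖(A *ᵥ v) i‖ ^ 2 = ∑ i, ‖v i‖ ^ 2 := by
  have h1 : ∑ i, conj ((A *ᵥ v) i) * (A *ᵥ v) i = ∑ i, conj (v i) * v i := by
    change star (A *ᵥ v) ⬝ᵥ (A *ᵥ v) = star v ⬝ᵥ v
    rw [star_mulVec, ← dotProduct_mulVec, mulVec_mulVec, hA, one_mulVec]
  rw [sum_conj_mul_self_eq, sum_conj_mul_self_eq] at h1
  exact_mod_cast h1

/-- Cauchy–Schwarz for the sesquilinear pairing on `ℂⁿ`:
`|Σ_i conj(u i) f i| ≤ √(Σ‖u i‖²) √(Σ‖f i‖²)`. -/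
theorem norm_sum_conj_mul_le (u f : n → ℂ) :
    ‖∑ i, conj (u i) * f i‖ ≤ Real.sqrt (∑ i, ‖u i‖ ^ 2) * Real.sqrt (∑ i, ‖f i‖ ^ 2) := by
  calc ‖∑ i, conj (u i) * f i‖ ≤ ∑ i, ‖conj (u i) * f i‖ := norm_sum_le _ _
    _ = ∑ i, ‖u i‖ * ‖f i‖ := by simp
    _ ≤ Real.sqrt (∑ i, ‖u i‖ ^ 2) * Real.sqrt (∑ i, ‖f i‖ ^ 2) :=
        Real.sum_mul_le_sqrt_mul_sqrt _ _ _

end Generic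

/-! ### The Hermitian part of the Wilson hopping matrices -/

section Hop

variable {L N : ℕ} [NeZero L] {G : Type*} [Group G] (ρ : G →* Matrix (Fin N) (Fin N) ℂ)

/-- **Hermitian part of `W_μ`.** For every field `v`,
`Re Σ_i conj(v i) (W_μ v)_i = Re Σ_i conj(v i) ((F_μ ⊗ 1) v)_i`: the chiral projectors drop out of
the Hermitian part since `(F_μᴴ ⊗ P⁺_μ)ᴴ = F_μ ⊗ P⁺_μ` and `P⁻_μ + P⁺_μ = 1`
(Montvay–Münster 1994, §4.2). No unitarity is needed. -/
theorem re_inner_wilsonHop_eq (U : GaugeConfig 4 L G) (μ : Fin 4)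
    (v : TorusSite 4 L × Fin N × Fin 4 → ℂ) :
    (∑ i, conj (v i) * (wilsonHop ρ U μ *ᵥ v) i).re =
      (∑ i, conj (v i) * (Matrix.reindex (Equiv.prodAssoc _ _ _) (Equiv.prodAssoc _ _ _)
        (linkHop ρ U μ ⊗ₖ (1 : Matrix (Fin 4) (Fin 4) ℂ)) *ᵥ v) i).re := by
  set F := linkHop ρ U μ with hF
  set e := Equiv.prodAssoc (TorusSite 4 L) (Fin N) (Fin 4) with he
  have hW : wilsonHop ρ U μ =
      Matrix.reindex e e (F ⊗ₖ chiralProjMinus μ) + Matrix.reindex e e (Fᴴ ⊗ₖ chiralProjPlus μ) :=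
    rfl
  have hY : (Matrix.reindex e e (Fᴴ ⊗ₖ chiralProjPlus μ))ᴴ =
      Matrix.reindex e e (F ⊗ₖ chiralProjPlus μ) := by
    rw [Matrix.reindex_apply, Matrix.reindex_apply, Matrix.conjTranspose_submatrix,
      Matrix.conjTranspose_kronecker, Matrix.conjTranspose_conjTranspose,
      chiralProjPlus_conjTranspose]
  have hsum : Matrix.reindex e e (F ⊗ₖ chiralProjMinus μ) + Matrix.reindex e e (F ⊗ₖ chiralProjPlus μ)
      = Matrix.reindex e e (F ⊗ₖ (1 : Matrix (Fin 4) (Fin 4) ℂ)) := by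
    rw [← chiralProjMinus_add_chiralProjPlus μ, Matrix.kronecker_add]
    rfl
  rw [hW, sum_conj_mul_add_mulVec, Complex.add_re,
    ← re_sum_conj_mul_mulVec_conjTranspose (Matrix.reindex e e (Fᴴ ⊗ₖ chiralProjPlus μ)), hY,
    ← Complex.add_re, ← sum_conj_mul_add_mulVec, hsum]

/-- **Entrywise action of the spin-blind covariant hop**:
`((F_μ ⊗ 1) v)(y,a,α) = Σ_b ρ(U(y,μ))_{ab} v(y+μ̂,b,α)`. -/
theorem reindex_linkHop_kronecker_one_mulVec (U : GaugeConfig 4 L G) (μ : Fin 4)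
    (v : TorusSite 4 L × Fin N × Fin 4 → ℂ) (y : TorusSite 4 L) (a : Fin N) (α : Fin 4) :
    (Matrix.reindex (Equiv.prodAssoc _ _ _) (Equiv.prodAssoc _ _ _)
        (linkHop ρ U μ ⊗ₖ (1 : Matrix (Fin 4) (Fin 4) ℂ)) *ᵥ v) (y, a, α) =
      ∑ b, ρ (U (y, μ)) a b * v (QuantumFieldTheory.Site.shift y μ, b, α) := by
  simp only [Matrix.mulVec, dotProduct, Matrix.reindex_apply, Matrix.submatrix_apply,
    Equiv.prodAssoc_symm_apply, Matrix.kroneckerMap_apply, linkHop, Matrix.of_apply]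
  rw [Fintype.sum_prod_type, Finset.sum_eq_single (QuantumFieldTheory.Site.shift y μ)]
  · rw [Fintype.sum_prod_type]
    refine Finset.sum_congr rfl fun b _ => ?_
    rw [Finset.sum_eq_single α]
    · simp
    · intro β _ hβ
      simp [Matrix.one_apply_ne (Ne.symm hβ)]
    · simp
  · intro z _ hz
    simp [if_neg hz]
  · simp

omit [NeZero L] in
/-- **The lattice diamagnetic (Kato) inequality, sitewise**: for unitary `ρ`,
`|Σ_{a,α} conj(v(y,a,α)) Σ_b ρ(U(y,μ))_{ab} v(y+μ̂,b,α)| ≤ |v|(y) |v|(y+μ̂)` with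
`|v|(y) = √(Σ_{a,α} |v(y,a,α)|²)`: the link acts isometrically on each spin component, then
Cauchy–Schwarz (Brydges–Fröhlich–Seiler 1979, §2). -/
theorem norm_site_inner_hop_le (hρ : ∀ g, ρ g ∈ Matrix.unitaryGroup (Fin N) ℂ)
    (U : GaugeConfig 4 L G) (μ : Fin 4) (v : TorusSite 4 L × Fin N × Fin 4 → ℂ)
    (y : TorusSite 4 L) :
    ‖∑ a, ∑ α, conj (v (y, a, α)) *
        ∑ b, ρ (U (y, μ)) a b * v (QuantumFieldTheory.Site.shift y μ, b, α)‖ ≤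
      Real.sqrt (∑ a, ∑ α, ‖v (y, a, α)‖ ^ 2) *
        Real.sqrt (∑ a, ∑ α, ‖v (QuantumFieldTheory.Site.shift y μ, a, α)‖ ^ 2) := by
  have hM : (ρ (U (y, μ)))ᴴ * ρ (U (y, μ)) = 1 := Matrix.mem_unitaryGroup_iff'.mp (hρ (U (y, μ)))
  -- the two colour ⊗ spin blocks, flattened to `Fin N × Fin 4`
  set f : Fin N × Fin 4 → ℂ := fun p =>
    ∑ b, ρ (U (y, μ)) p.1 b * v (QuantumFieldTheory.Site.shift y μ, b, p.2) with hf
  set u : Fin N × Fin 4 → ℂ := fun p => v (y, p.1, p.2) with hu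
  have hfl : ∑ a, ∑ α, conj (v (y, a, α)) *
      ∑ b, ρ (U (y, μ)) a b * v (QuantumFieldTheory.Site.shift y μ, b, α) =
        ∑ p, conj (u p) * f p := by
    rw [Fintype.sum_prod_type]
  have huu : ∑ p, ‖u p‖ ^ 2 = ∑ a, ∑ α, ‖v (y, a, α)‖ ^ 2 := by
    rw [Fintype.sum_prod_type]
  -- unitarity: `Σ_{a,α} |f_{aα}|² = |v|(y+μ̂)²`, spin index by spin index
  have hff : ∑ p, ‖f p‖ ^ 2 = ∑ a, ∑ α, ‖v (QuantumFieldTheory.Site.shift y μ, a, α)‖ ^ 2 := by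
    rw [Fintype.sum_prod_type, Finset.sum_comm]
    conv_rhs => rw [Finset.sum_comm]
    refine Finset.sum_congr rfl fun α _ => ?_
    have h := sum_norm_sq_mulVec_of_isometry _ hM
      (fun b => v (QuantumFieldTheory.Site.shift y μ, b, α))
    simpa only [Matrix.mulVec, dotProduct, hf] using h
  rw [hfl, ← huu, ← hff]
  exact norm_sum_conj_mul_le u f

/-- **Diamagnetic bound for the hopping form**: for unitary `ρ` and every field `v`,
`Re Σ_i conj(v i) (W_μ v)_i ≤ Σ_y |v|(y) |v|(y+μ̂)`, `|v|(y) = √(Σ_{a,α} |v(y,a,α)|²)`. -/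
theorem re_inner_wilsonHop_le (hρ : ∀ g, ρ g ∈ Matrix.unitaryGroup (Fin N) ℂ)
    (U : GaugeConfig 4 L G) (μ : Fin 4) (v : TorusSite 4 L × Fin N × Fin 4 → ℂ) :
    (∑ i, conj (v i) * (wilsonHop ρ U μ *ᵥ v) i).re ≤
      ∑ y, Real.sqrt (∑ a, ∑ α, ‖v (y, a, α)‖ ^ 2) *
        Real.sqrt (∑ a, ∑ α, ‖v (QuantumFieldTheory.Site.shift y μ, a, α)‖ ^ 2) := by
  rw [re_inner_wilsonHop_eq ρ U μ v]
  have hexp : (∑ i, conj (v i) * (Matrix.reindex (Equiv.prodAssoc _ _ _) (Equiv.prodAssoc _ _ _)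
      (linkHop ρ U μ ⊗ₖ (1 : Matrix (Fin 4) (Fin 4) ℂ)) *ᵥ v) i) =
      ∑ y, ∑ a, ∑ α, conj (v (y, a, α)) *
        ∑ b, ρ (U (y, μ)) a b * v (QuantumFieldTheory.Site.shift y μ, b, α) := by
    rw [Fintype.sum_prod_type]
    refine Finset.sum_congr rfl fun y _ => ?_
    rw [Fintype.sum_prod_type]
    refine Finset.sum_congr rfl fun a _ => Finset.sum_congr rfl fun α _ => ?_
    rw [reindex_linkHop_kronecker_one_mulVec]
  rw [hexp, Complex.re_sum]
  exact Finset.sum_le_sum fun y _ =>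
    (Complex.re_le_norm _).trans (norm_site_inner_hop_le ρ hρ U μ v y)

end Hop

end Summit.QuantumFields.QCD.Theorems.KineticEdge

end
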